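import Summits.QuantumFields.BalabanUV.Beta.GAN24.DirichletBoxPairing

/-!
# `BalabanUV.Beta.GAN24.DirichletBoxPairingBound` — binder row G-an2-4 / (CONV-C), road P2 PART II, module M-P (file 2 of 2): THE
# POINTWISE WINDOW FORMULA and THE GLOBAL TWO-LEVEL PAIRING BOUND (C-glob), Fourier-free (unit b2b-balaban-gan24-p2, gen 22, v1)

HONEST FRAMING (cell contract, verbatim): «discharging `BetaPertH` makes Bałaban's UV stability UNCONDITIONAL — a real constructive-QFT
result; it is NOT the continuum limit and NOT the Clay problem.»  SUPPLIER item under the T⁴-DAG sub-row `T4-U1a.S-NE2-D1-DIRICHLET°`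
(holder: the t4-ne2-p1 lineage; wall `hinj`), memo `HOME/b2b-balaban-gan24-p2/gen22/DIRICHLET-BOX-TWOLEVEL.md` step L2.  File 1
(`DirichletBoxPairing`) proved `J₀·Δ − Δ′·J₀ = Σ_μ (A_μ − F_μ)ᴴ∂_μ` and `A_μ − F_μ = N√(R^d)·Q₀N⁰_μ·p_R(S′_μ)`, `p_R = (X − 1)²·W_R`
(`DirichletBoxWindowPoly`: `‖coeff_n W_R‖ ≤ R²`, `2R − 2` coefficients).  THIS FILE reads it pointwise and sums it:

 * §3 **`Aop_sub_Fop_mulVec`**: `((A_μ − F_μ)v)(y) = cWin·Σ_{j: j_μ=0} Σ_{n<2R−2} w_n·(∂′_μᴴ∂′_μ v)(R·y + j + (n+1)e_μ)` with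
   `‖cWin‖·R² = (N·√(R^d))⁻¹`, hence **`norm_Aop_sub_Fop_mulVec_le`**: `|((A_μ − F_μ)v)(y)| ≤ (N·√(R^d))⁻¹·Σ_{window(y,μ)} |(∂′_μᴴ∂′_μ v)(x)|`
   — the two-level pairing sees only SECOND differences of `v`, on the `2R − 2` fine `μ`-layers astride the far `μ`-face of the block of
   `y` (this pointwise form is what the Dirichlet assembly, module M-E, splits into INTERIOR second differences and BOUNDARY normal traces);
 * §4 the window combinatorics (`sum_layers_sweep`: one sweep of the first layers covers the torus once; **`sum_window_le`**: every
   fine site lies in at most two windows; `#{j : j_μ = 0}·R = R^d`) and **`norm_pairing_le`** (C-glob):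
   `|⟨v, (J₀Δ − Δ′J₀)u⟩| ≤ (2/N)·Σ_μ ‖∂_μu‖·‖∂′_μᴴ∂′_μ v‖` for ALL `u ∈ ℓ²(T)`, `v ∈ ℓ²(T′)` — with `‖∂_μ(D^Ω)⁻¹f‖ ≤ √(γ′⁻¹)‖f‖` and
   `‖Δ′(D′)⁻¹‖ ≤ 1 + a′γ′⁻¹` this is already a FOURIER-FREE TORUS injected law with a dimension-free constant (cross-check of
   `EffectiveLaplacianExcess.freeTowerLaws_king_scalar`, whose constant is `2d√(γ′⁻¹) + (1 + 5^d(1+4d))(1 + a′γ′⁻¹)²`).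

ABSOLUTE RULE (cell, verbatim): «No internally-minted statement may enter as a cited fact. Every hypothesis is either kernel-proved in
this package or a verbatim quotation of a PUBLISHED theorem with page reference. The manuscript(s) under audit are NOT citable for
their own disputed steps — they are the thing under adjudication; programme-internal (2001/route/tribunal) claims are never citable.»
[folklore] finite lattice calculus; nothing printed is a hypothesis.  NOT CLAIMED: NE2, the torus rates of `G_k`/`H_k` as printed objects,
(CONV-C) as a whole, `BetaPertH`, continuum, Clay.  «not in print; our proof attempt».  HONEST DEPENDENCY: continuum YM on T⁴ ⇐ BetaPertH ∧
nine spine estimates (0/9 proved); BetaPertH ⇐ (D1) ∧ (D4) ∧ CAP+tail; G-an2-4 gates asym, D1 and NE2/3/4.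
-/

noncomputable section

open scoped BigOperators ComplexConjugate Matrix Matrix.Norms.L2Operator
open Finset Polynomial

namespace Summit.QuantumFields.BalabanUV.Beta.GAN24.DirichletBoxPairing

open Literature.MathematicalPhysics.QuantumFieldTheory.Balaban1983to89.B5Prop11Plancherel (Tor fine unitVec)
open Literature.MathematicalPhysics.QuantumFieldTheory.Balaban1983to89.B5Action121 (shiftS sdiff LapS shiftS_mulVec sdiff_mulVec
  sdiff_conjTranspose_mulVec star_mulVec_dotProduct dotProduct_mulVec_eq_star_conjTranspose_mulVec)
open Literature.MathematicalPhysics.QuantumFieldTheory.Balaban1983to89.B5Prop11Lower (nsq nsq_nonneg star_dotProduct_self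
  norm_star_dotProduct_le)
open Literature.MathematicalPhysics.QuantumFieldTheory.Balaban1983to89.B5Block118 (tstep tstep_zero tstep_succ)
open Literature.MathematicalPhysics.QuantumFieldTheory.Balaban1983to89.B5G183RateTorus (cpt)
open Literature.MathematicalPhysics.QuantumFieldTheory.Balaban1983to89.B5G183RateTorusW (off)
open Summit.QuantumFields.BalabanUV.T4Continuum
open Summit.QuantumFields.BalabanUV.T4Continuum.BalabanAveragedTowerModes (par rem par_cpt_add_off rem_cpt_add_off val_cpt_add_off)
open Summit.QuantumFields.BalabanUV.T4Continuum.BalabanBlockPoincare (tileEquiv)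
open Summit.QuantumFields.BalabanUV.T4Continuum.ScalarMassTower (cpt_add_unitVec)
open Summit.QuantumFields.BalabanUV.T4Continuum.ScalarBlockPlanting (Qavg0 JK0 Qavg0_mul_apply sum_fine_eq_sum_tile star_Qavg0_apply)
open Summit.QuantumFields.BalabanUV.T4Continuum.ScalarPlantingFaces (faceF0 sdiff_mul_JK0)
open Summit.QuantumFields.BalabanUV.T4Continuum.ScalarSandwichReduction (Qavg0_mul_shiftS_pow shiftS_mul_apply shiftS_pow_mul_apply)
open Summit.QuantumFields.BalabanUV.Beta.GAN24.DirichletBoxRegularity (Pdir Pdir_mulVec)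
open Summit.QuantumFields.BalabanUV.Beta.GAN24.DirichletBoxWindowPoly (sig ppoly wpoly ppoly_eq wpoly_eq_sum norm_coeff_wpoly_le)

variable {d : ℕ} (N R : ℕ) [NeZero N] [NeZero R] (M : Fin d → ℕ) [hM : ∀ μ, NeZero (M μ)]

/-! ## §3 The pointwise window formula and bound -/

omit [NeZero N] [NeZero R] hM in
/-- a matrix acting on a vector = the matrix times the one-column matrix of the vector. [folklore] -/
theorem mulVec_eq_mul_of {α β : Type*} [Fintype β] (A : Matrix α β ℂ) (v : β → ℂ) (i : α) :
    (A *ᵥ v) i = (A * Matrix.of (fun j (_ : Unit) => v j)) i () := by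
  simp [Matrix.mulVec, dotProduct, Matrix.mul_apply]

/-- `(S_ν^t g)(x) = g(x + t·e_ν)` on vectors. [folklore] -/
theorem shiftS_pow_mulVec {Nf : Fin d → ℕ} [∀ μ, NeZero (Nf μ)] (ν : Fin d) (g : Tor Nf → ℂ) :
    ∀ (t : ℕ) (x : Tor Nf), (shiftS Nf ν ^ t *ᵥ g) x = g (x + tstep Nf ν t)
  | 0, x => by rw [pow_zero, Matrix.one_mulVec, tstep_zero, add_zero]
  | t + 1, x => by
    rw [pow_succ, ← Matrix.mulVec_mulVec, shiftS_pow_mulVec ν _ t x, shiftS_mulVec, tstep_succ, add_assoc]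

/-- the window polynomial acts through its `2R − 2` coefficients: `(W_R(S′_μ)g)(x) = Σ_{n<2R−2} w_n·g(x + n·e_μ)`. [folklore] -/
theorem aeval_wpoly_mulVec (μ : Fin d) (g : Tor (fine (R * N) M) → ℂ) (x : Tor (fine (R * N) M)) :
    (Polynomial.aeval (shiftS (fine (R * N) M) μ) (wpoly R) *ᵥ g) x
      = ∑ n ∈ range (2 * R - 2), (wpoly R).coeff n * g (x + tstep (fine (R * N) M) μ n) := by
  conv_lhs => rw [wpoly_eq_sum R]
  simp only [map_sum, map_mul, Polynomial.aeval_C, Algebra.algebraMap_eq_smul_one, map_pow, Polynomial.aeval_X,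
    smul_mul_assoc, one_mul, Matrix.sum_mulVec, Finset.sum_apply, Matrix.smul_mulVec, Pi.smul_apply, smul_eq_mul,
    shiftS_pow_mulVec]

/-- `(S′_μ − 1)²` is a (translated) second difference: `((S′ − 1)²v)(x) = −(c̄c)⁻¹·(∂′_μᴴ∂′_μ v)(x + e_μ)`, `c = RN`. [folklore] -/
theorem sq_shift_sub_one_mulVec (μ : Fin d) (v : Tor (fine (R * N) M) → ℂ) (x : Tor (fine (R * N) M)) :
    ((shiftS (fine (R * N) M) μ - 1) ^ 2 *ᵥ v) x
      = -((conj (((R * N : ℕ) : ℂ)) * ((R * N : ℕ) : ℂ))⁻¹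
          * (Pdir (fine (R * N) M) ((R * N : ℕ) : ℂ) μ *ᵥ v) (x + unitVec (fine (R * N) M) μ)) := by
  have hc : (conj (((R * N : ℕ) : ℂ)) * ((R * N : ℕ) : ℂ)) ≠ 0 := by
    rw [Complex.conj_natCast]
    exact mul_ne_zero (by exact_mod_cast NeZero.ne (R * N)) (by exact_mod_cast NeZero.ne (R * N))
  have hw : ∀ (g : Tor (fine (R * N) M) → ℂ) (z : Tor (fine (R * N) M)),
      ((shiftS (fine (R * N) M) μ - 1) *ᵥ g) z = g (z + unitVec (fine (R * N) M) μ) - g z := fun g z => by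
    rw [Matrix.sub_mulVec, Matrix.one_mulVec, Pi.sub_apply, shiftS_mulVec]
  rw [pow_two, ← Matrix.mulVec_mulVec, hw, hw, hw, Pdir_mulVec, add_sub_cancel_right, inv_mul_cancel_left₀ hc]
  ring

/-- `p_R(S′) = W_R(S′)·(S′ − 1)²`. [folklore] -/
theorem aeval_ppoly_eq_mul (μ : Fin d) :
    Polynomial.aeval (shiftS (fine (R * N) M) μ) (ppoly R)
      = Polynomial.aeval (shiftS (fine (R * N) M) μ) (wpoly R) * (shiftS (fine (R * N) M) μ - 1) ^ 2 := by
  rw [ppoly_eq, mul_comm ((X - 1) ^ 2 : ℂ[X]) (wpoly R), map_mul, map_pow, map_sub, Polynomial.aeval_X, map_one]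

/-- rows of `Q₀N⁰_μ` on vectors: first-layer sums. [folklore] -/
theorem Qavg0_firstL_mulVec (μ : Fin d) (w : Tor (fine (R * N) M) → ℂ) (y : Tor (fine N M)) :
    ((Qavg0 N R M * firstL N R M μ) *ᵥ w) y
      = ((R : ℂ) ^ d)⁻¹ * ∑ j ∈ univ.filter (fun j : Fin d → Fin R => (j μ : ℕ) = 0), w (cpt N R M y + off N R M j) := by
  have h := Qavg0_firstL_shiftS_pow_mul_apply N R M μ 0 (Matrix.of (fun j (_ : Unit) => w j)) y ()
  rw [pow_zero, Matrix.mul_one] at h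
  rw [mulVec_eq_mul_of, h]
  simp only [tstep_zero, add_zero, Matrix.of_apply]

/-- the window constant: `N√(R^d)·R^{−d}·(RN)^{−2}… = (N·√(R^d))⁻¹` after the weights `≤ R²`. [folklore] -/
def cWin (d N R : ℕ) : ℂ :=
  -(cAF d N R * ((R : ℂ) ^ d)⁻¹ * (conj (((R * N : ℕ) : ℂ)) * ((R * N : ℕ) : ℂ))⁻¹)

/-- **THE POINTWISE WINDOW FORMULA**: `((A_μ − F_μ)v)(y) = cWin·Σ_{j: j_μ=0} Σ_{n<2R−2} w_n·(∂′_μᴴ∂′_μv)(R·y + j + (n+1)e_μ)` —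
the two-level pairing sees only second differences of `v`, on the `2R − 2` fine `μ`-layers astride the far `μ`-face of the block of `y`.
[folklore] -/
theorem Aop_sub_Fop_mulVec (μ : Fin d) (v : Tor (fine (R * N) M) → ℂ) (y : Tor (fine N M)) :
    ((Aop N R M μ - Fop N R M μ) *ᵥ v) y
      = cWin d N R * ∑ j ∈ univ.filter (fun j : Fin d → Fin R => (j μ : ℕ) = 0), ∑ n ∈ range (2 * R - 2),
          (wpoly R).coeff n * (Pdir (fine (R * N) M) ((R * N : ℕ) : ℂ) μ *ᵥ v)
            (cpt N R M y + off N R M j + tstep (fine (R * N) M) μ (n + 1)) := by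
  rw [Aop_sub_Fop_eq, Matrix.smul_mulVec, Pi.smul_apply, smul_eq_mul, ← Matrix.mulVec_mulVec,
    Qavg0_firstL_mulVec, aeval_ppoly_eq_mul, cWin]
  simp only [← Matrix.mulVec_mulVec, aeval_wpoly_mulVec, sq_shift_sub_one_mulVec, tstep_succ, ← add_assoc]
  simp only [Finset.mul_sum, neg_mul]
  refine Finset.sum_congr rfl fun j _ => Finset.sum_congr rfl fun n _ => ?_
  ring

/-- `‖cWin‖·R² = (N·√(R^d))⁻¹`. [folklore] -/
theorem norm_cWin_mul_sq : ‖cWin d N R‖ * (R : ℝ) ^ 2 = ((N : ℝ) * Real.sqrt ((R : ℝ) ^ d))⁻¹ := by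
  have hR : (0 : ℝ) < R := by exact_mod_cast Nat.pos_of_ne_zero (NeZero.ne R)
  have hN : (0 : ℝ) < N := by exact_mod_cast Nat.pos_of_ne_zero (NeZero.ne N)
  have hRd : (0 : ℝ) < (R : ℝ) ^ d := pow_pos hR d
  have hs : 0 < Real.sqrt ((R : ℝ) ^ d) := Real.sqrt_pos.mpr hRd
  have hss : Real.sqrt ((R : ℝ) ^ d) * Real.sqrt ((R : ℝ) ^ d) = (R : ℝ) ^ d := Real.mul_self_sqrt hRd.le
  rw [cWin, norm_neg, norm_mul, norm_mul, norm_cAF, norm_inv, norm_inv, norm_mul, Complex.norm_natCast, norm_pow,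
    Complex.norm_natCast, Complex.conj_natCast, Complex.norm_natCast]
  push_cast
  field_simp
  nlinarith [hss]

/-- **THE POINTWISE WINDOW BOUND**: `|((A_μ − F_μ)v)(y)| ≤ (N·√(R^d))⁻¹·Σ_{j: j_μ=0} Σ_{n<2R−2} |(∂′_μᴴ∂′_μv)(R·y + j + (n+1)e_μ)|`.
[folklore] -/
theorem norm_Aop_sub_Fop_mulVec_le (μ : Fin d) (v : Tor (fine (R * N) M) → ℂ) (y : Tor (fine N M)) :
    ‖((Aop N R M μ - Fop N R M μ) *ᵥ v) y‖
      ≤ ((N : ℝ) * Real.sqrt ((R : ℝ) ^ d))⁻¹ *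
          ∑ j ∈ univ.filter (fun j : Fin d → Fin R => (j μ : ℕ) = 0), ∑ n ∈ range (2 * R - 2),
            ‖(Pdir (fine (R * N) M) ((R * N : ℕ) : ℂ) μ *ᵥ v) (cpt N R M y + off N R M j + tstep (fine (R * N) M) μ (n + 1))‖ := by
  rw [Aop_sub_Fop_mulVec, norm_mul, ← norm_cWin_mul_sq N R, mul_assoc]
  refine mul_le_mul_of_nonneg_left ?_ (norm_nonneg _)
  rw [Finset.mul_sum]
  refine (norm_sum_le _ _).trans (Finset.sum_le_sum fun j _ => ?_)
  rw [Finset.mul_sum]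
  refine (norm_sum_le _ _).trans (Finset.sum_le_sum fun n _ => ?_)
  rw [norm_mul]
  exact mul_le_mul_of_nonneg_right (norm_coeff_wpoly_le R n) (norm_nonneg _)

/-! ## §4 The global bound (C-glob): each fine site lies in at most two windows -/

/-- sums over the fine torus, tiled by blocks (any additive target). [folklore] -/
theorem sum_fine_eq_sum_tile' {β : Type*} [AddCommMonoid β] (g : Tor (fine (R * N) M) → β) :
    ∑ x, g x = ∑ y : Tor (fine N M), ∑ j : Fin d → Fin R, g (cpt N R M y + off N R M j) := by
  rw [← Fintype.sum_equiv (tileEquiv N R M) (fun p => g (tileEquiv N R M p)) g (fun _ => rfl), Fintype.sum_prod_type]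
  rfl

/-- one full sweep of the first layers covers the torus exactly once: `Σ_y Σ_{j: j_μ=0} Σ_{s<R} g(R·y + j + s·e_μ) = Σ_x g(x)`. [folklore] -/
theorem sum_layers_sweep {β : Type*} [AddCommMonoid β] (μ : Fin d) (g : Tor (fine (R * N) M) → β) :
    ∑ y : Tor (fine N M), ∑ j ∈ univ.filter (fun j : Fin d → Fin R => (j μ : ℕ) = 0), ∑ s ∈ range R,
        g (cpt N R M y + off N R M j + tstep (fine (R * N) M) μ s) = ∑ x, g x := by
  rw [sum_fine_eq_sum_tile' N R M]
  refine Finset.sum_congr rfl fun y _ => ?_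
  rw [sum_block_eq_sum_layers N R M μ y g, Finset.sum_comm, ← Fin.sum_univ_eq_sum_range]

/-- the same sweep started one block further (`s ↦ R + s`), re-indexed by `y ↦ y + e_μ`. [folklore] -/
theorem sum_layers_sweep_succ {β : Type*} [AddCommMonoid β] (μ : Fin d) (g : Tor (fine (R * N) M) → β) :
    ∑ y : Tor (fine N M), ∑ j ∈ univ.filter (fun j : Fin d → Fin R => (j μ : ℕ) = 0), ∑ s ∈ range R,
        g (cpt N R M y + off N R M j + tstep (fine (R * N) M) μ (R + s)) = ∑ x, g x := by
  have e : ∀ (y : Tor (fine N M)) (j : Fin d → Fin R) (s : ℕ),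
      cpt N R M y + off N R M j + tstep (fine (R * N) M) μ (R + s)
        = cpt N R M (y + unitVec (fine N M) μ) + off N R M j + tstep (fine (R * N) M) μ s := by
    intro y j s
    have ht : tstep (fine (R * N) M) μ (R + s) = tstep (fine (R * N) M) μ R + tstep (fine (R * N) M) μ s := by
      funext ν; simp only [tstep, Pi.add_apply]; split_ifs <;> push_cast <;> ring
    rw [cpt_add_unitVec, ht]
    abel
  simp_rw [e]
  rw [← sum_layers_sweep N R M μ g]
  exact Fintype.sum_equiv (Equiv.addRight (unitVec (fine N M) μ)) _ _ (fun _ => rfl)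

/-- the number of first-layer offsets times `R` is the block size: `#{j : j_μ = 0}·R = R^d`. [folklore] -/
theorem card_firstLayer_mul (μ : Fin d) :
    ((univ.filter (fun j : Fin d → Fin R => (j μ : ℕ) = 0)).card : ℝ) * R = (R : ℝ) ^ d := by
  have h := sum_update_layers R (β := ℝ) μ (fun _ => (1 : ℝ))
  simp only [Finset.sum_const, Finset.card_univ, nsmul_eq_mul, mul_one, Fintype.card_pi, Fintype.card_fin,
    Finset.prod_const] at h
  push_cast at h
  rw [h, mul_comm]

/-- **EACH FINE SITE LIES IN AT MOST TWO WINDOWS**: for `g ≥ 0`,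
`Σ_y Σ_{j: j_μ=0} Σ_{n<2R−2} g(R·y + j + (n+1)e_μ) ≤ 2·Σ_x g(x)`. [folklore] -/
theorem sum_window_le (μ : Fin d) {g : Tor (fine (R * N) M) → ℝ} (hg : ∀ x, 0 ≤ g x) :
    ∑ y : Tor (fine N M), ∑ j ∈ univ.filter (fun j : Fin d → Fin R => (j μ : ℕ) = 0), ∑ n ∈ range (2 * R - 2),
        g (cpt N R M y + off N R M j + tstep (fine (R * N) M) μ (n + 1)) ≤ 2 * ∑ x, g x := by
  -- per base point, `{n+1 : n < 2R−2} ⊆ [0,R) ∪ (R + [0,R))`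
  have hwin : ∀ z : Tor (fine (R * N) M),
      ∑ n ∈ range (2 * R - 2), g (z + tstep (fine (R * N) M) μ (n + 1))
        ≤ ∑ s ∈ range R, g (z + tstep (fine (R * N) M) μ s) + ∑ s ∈ range R, g (z + tstep (fine (R * N) M) μ (R + s)) := by
    intro z
    have hsplit : ∑ n ∈ range (2 * R - 2), g (z + tstep (fine (R * N) M) μ (n + 1))
        ≤ ∑ m ∈ range (2 * R), g (z + tstep (fine (R * N) M) μ m) := by
      have himg : (range (2 * R - 2)).image (fun n => n + 1) ⊆ range (2 * R) := by
        intro m hm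
        obtain ⟨n, hn, rfl⟩ := Finset.mem_image.mp hm
        have := Finset.mem_range.mp hn
        exact Finset.mem_range.mpr (by omega)
      calc ∑ n ∈ range (2 * R - 2), g (z + tstep (fine (R * N) M) μ (n + 1))
          = ∑ m ∈ (range (2 * R - 2)).image (fun n => n + 1), g (z + tstep (fine (R * N) M) μ m) := by
            rw [Finset.sum_image (fun a _ b _ h => by simpa using h)]
        _ ≤ ∑ m ∈ range (2 * R), g (z + tstep (fine (R * N) M) μ m) :=
            Finset.sum_le_sum_of_subset_of_nonneg himg (fun m _ _ => hg _)
    refine hsplit.trans (le_of_eq ?_)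
    rw [two_mul, Finset.sum_range_add]
  calc ∑ y : Tor (fine N M), ∑ j ∈ univ.filter (fun j : Fin d → Fin R => (j μ : ℕ) = 0), ∑ n ∈ range (2 * R - 2),
          g (cpt N R M y + off N R M j + tstep (fine (R * N) M) μ (n + 1))
      ≤ ∑ y : Tor (fine N M), ∑ j ∈ univ.filter (fun j : Fin d → Fin R => (j μ : ℕ) = 0),
          ((∑ s ∈ range R, g (cpt N R M y + off N R M j + tstep (fine (R * N) M) μ s))
            + ∑ s ∈ range R, g (cpt N R M y + off N R M j + tstep (fine (R * N) M) μ (R + s))) :=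
        Finset.sum_le_sum fun y _ => Finset.sum_le_sum fun j _ => hwin _
    _ = ∑ x, g x + ∑ x, g x := by
        simp only [Finset.sum_add_distrib]
        rw [sum_layers_sweep N R M μ g, sum_layers_sweep_succ N R M μ g]
    _ = 2 * ∑ x, g x := by ring

/-- **(C-glob) THE GLOBAL TWO-LEVEL PAIRING BOUND**, Fourier-free: for ALL `u ∈ ℓ²(T)`, `v ∈ ℓ²(T′)`,
`|⟨v, (J₀Δ − Δ′J₀)u⟩| ≤ (2/N)·Σ_μ ‖∂_μu‖·‖∂′_μᴴ∂′_μ v‖` (`N` = number of coarse sites per unit length, i.e. the rate `η`).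
[folklore] -/
theorem norm_pairing_le (hN : 1 ≤ N) (u : Tor (fine N M) → ℂ) (v : Tor (fine (R * N) M) → ℂ) :
    ‖star v ⬝ᵥ ((JK0 N R M * LapS (fine N M) (N : ℂ) - LapS (fine (R * N) M) ((R * N : ℕ) : ℂ) * JK0 N R M) *ᵥ u)‖
      ≤ 2 / (N : ℝ) * ∑ μ, Real.sqrt (nsq (sdiff (fine N M) (N : ℂ) μ *ᵥ u))
          * Real.sqrt (nsq (Pdir (fine (R * N) M) ((R * N : ℕ) : ℂ) μ *ᵥ v)) := by
  have hRpos : (0 : ℝ) < R := by exact_mod_cast Nat.pos_of_ne_zero (NeZero.ne R)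
  have hNpos : (0 : ℝ) < N := by exact_mod_cast Nat.pos_of_ne_zero (NeZero.ne N)
  have hRd : (0 : ℝ) < (R : ℝ) ^ d := pow_pos hRpos d
  have hsq : 0 < Real.sqrt ((R : ℝ) ^ d) := Real.sqrt_pos.mpr hRd
  rw [pairing_identity N R M hN, Matrix.sum_mulVec, dotProduct_sum, Finset.mul_sum]
  refine (norm_sum_le _ _).trans (Finset.sum_le_sum fun μ _ => ?_)
  -- one direction
  set a : Tor (fine N M) → ℂ := (Aop N R M μ - Fop N R M μ) *ᵥ v with ha
  set b : Tor (fine N M) → ℂ := sdiff (fine N M) (N : ℂ) μ *ᵥ u with hb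
  set P : Tor (fine (R * N) M) → ℂ := Pdir (fine (R * N) M) ((R * N : ℕ) : ℂ) μ *ᵥ v with hP
  set F : Finset (Fin d → Fin R) := univ.filter (fun j : Fin d → Fin R => (j μ : ℕ) = 0) with hF
  have hpair : star v ⬝ᵥ (((Aop N R M μ - Fop N R M μ)ᴴ * sdiff (fine N M) (N : ℂ) μ) *ᵥ u) = star a ⬝ᵥ b := by
    rw [← Matrix.mulVec_mulVec, dotProduct_mulVec_eq_star_conjTranspose_mulVec, Matrix.conjTranspose_conjTranspose]
  rw [hpair]
  -- `|⟨a, b⟩| ≤ Σ_y |a y|·|b y| ≤ (N√R^d)⁻¹ Σ_y Σ_{j,n} |P(site)|·|b y|`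
  have h1 : ‖star a ⬝ᵥ b‖ ≤ ∑ y, ‖a y‖ * ‖b y‖ := by
    refine (norm_sum_le _ _).trans (Finset.sum_le_sum fun y _ => ?_)
    rw [Pi.star_apply, norm_mul, norm_star]
  have h2 : ∑ y, ‖a y‖ * ‖b y‖ ≤ ((N : ℝ) * Real.sqrt ((R : ℝ) ^ d))⁻¹ *
      ∑ y, ∑ j ∈ F, ∑ n ∈ range (2 * R - 2),
        ‖P (cpt N R M y + off N R M j + tstep (fine (R * N) M) μ (n + 1))‖ * ‖b y‖ := by
    rw [Finset.mul_sum]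
    refine Finset.sum_le_sum fun y _ => ?_
    have hy := norm_Aop_sub_Fop_mulVec_le N R M μ v y
    rw [← ha, ← hP] at hy
    calc ‖a y‖ * ‖b y‖ ≤ (((N : ℝ) * Real.sqrt ((R : ℝ) ^ d))⁻¹ * ∑ j ∈ F, ∑ n ∈ range (2 * R - 2),
          ‖P (cpt N R M y + off N R M j + tstep (fine (R * N) M) μ (n + 1))‖) * ‖b y‖ :=
          mul_le_mul_of_nonneg_right hy (norm_nonneg _)
      _ = _ := by rw [mul_assoc, Finset.sum_mul]; congr 1; refine Finset.sum_congr rfl fun j _ => ?_; rw [Finset.sum_mul]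
  -- Cauchy–Schwarz over the triple index
  have h3 : ∑ y, ∑ j ∈ F, ∑ n ∈ range (2 * R - 2),
        ‖P (cpt N R M y + off N R M j + tstep (fine (R * N) M) μ (n + 1))‖ * ‖b y‖
      ≤ Real.sqrt (2 * nsq P) * Real.sqrt (2 * (R : ℝ) ^ d * nsq b) := by
    rw [← Finset.sum_product', ← Finset.sum_product']
    refine (Real.sum_mul_le_sqrt_mul_sqrt _ _ _).trans ?_
    refine mul_le_mul (Real.sqrt_le_sqrt ?_) (Real.sqrt_le_sqrt ?_) (Real.sqrt_nonneg _) (Real.sqrt_nonneg _)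
    · rw [Finset.sum_product, Finset.sum_product]
      have hw := sum_window_le N R M μ (g := fun x => ‖P x‖ ^ 2) (fun x => by positivity)
      rw [hF]
      exact hw
    · rw [Finset.sum_product, Finset.sum_product]
      simp only [Finset.sum_const, Finset.card_range, nsmul_eq_mul]
      rw [← Finset.mul_sum, ← Finset.mul_sum]
      have hcard := card_firstLayer_mul R (d := d) μ
      rw [← hF] at hcard
      have hR2 : ((2 * R - 2 : ℕ) : ℝ) ≤ 2 * R := by
        have : 2 * R - 2 ≤ 2 * R := Nat.sub_le _ _
        exact_mod_cast this
      have hnsq : ∑ y, ‖b y‖ ^ 2 = nsq b := rfl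
      rw [hnsq]
      calc (F.card : ℝ) * (((2 * R - 2 : ℕ) : ℝ) * nsq b) ≤ (F.card : ℝ) * ((2 * R) * nsq b) := by
            refine mul_le_mul_of_nonneg_left (mul_le_mul_of_nonneg_right hR2 (nsq_nonneg _)) (Nat.cast_nonneg _)
        _ = 2 * ((F.card : ℝ) * R) * nsq b := by ring
        _ = 2 * (R : ℝ) ^ d * nsq b := by rw [hcard]
  -- assemble the constants: `(N√R^d)⁻¹·√2·√(2R^d) = 2/N`
  have h4 : ((N : ℝ) * Real.sqrt ((R : ℝ) ^ d))⁻¹ * (Real.sqrt (2 * nsq P) * Real.sqrt (2 * (R : ℝ) ^ d * nsq b))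
      = 2 / (N : ℝ) * (Real.sqrt (nsq b) * Real.sqrt (nsq P)) := by
    rw [Real.sqrt_mul (by norm_num : (0 : ℝ) ≤ 2) (nsq P), Real.sqrt_mul (by positivity : (0 : ℝ) ≤ 2 * (R : ℝ) ^ d) (nsq b),
      Real.sqrt_mul (by norm_num : (0 : ℝ) ≤ 2) ((R : ℝ) ^ d)]
    have h2s : Real.sqrt 2 * Real.sqrt 2 = 2 := Real.mul_self_sqrt (by norm_num)
    have hsN : Real.sqrt ((R : ℝ) ^ d) * ((N : ℝ) * Real.sqrt ((R : ℝ) ^ d))⁻¹ = (N : ℝ)⁻¹ := by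
      field_simp
    calc ((N : ℝ) * Real.sqrt ((R : ℝ) ^ d))⁻¹ * (Real.sqrt 2 * Real.sqrt (nsq P)
          * (Real.sqrt 2 * Real.sqrt ((R : ℝ) ^ d) * Real.sqrt (nsq b)))
        = (Real.sqrt 2 * Real.sqrt 2) * (Real.sqrt ((R : ℝ) ^ d) * ((N : ℝ) * Real.sqrt ((R : ℝ) ^ d))⁻¹)
          * (Real.sqrt (nsq b) * Real.sqrt (nsq P)) := by ring
      _ = 2 / (N : ℝ) * (Real.sqrt (nsq b) * Real.sqrt (nsq P)) := by rw [h2s, hsN, div_eq_mul_inv]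
  calc ‖star a ⬝ᵥ b‖ ≤ ∑ y, ‖a y‖ * ‖b y‖ := h1
    _ ≤ _ := h2
    _ ≤ ((N : ℝ) * Real.sqrt ((R : ℝ) ^ d))⁻¹ * (Real.sqrt (2 * nsq P) * Real.sqrt (2 * (R : ℝ) ^ d * nsq b)) :=
        mul_le_mul_of_nonneg_left h3 (by positivity)
    _ = 2 / (N : ℝ) * (Real.sqrt (nsq b) * Real.sqrt (nsq P)) := h4

end Summit.QuantumFields.BalabanUV.Beta.GAN24.DirichletBoxPairing

end
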